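/-
Copyright (c) 2026. All rights reserved.
Released under Apache 2.0 license as described in the file LICENSE.
-/
import Summits.HodgeConjecture.HodgeConjecture.Theorems.K2E1St1383LetterOfPinned1383         -- ★ p855340 (this seat): `PinnedEq1383Hyp`
import Literature.NumberTheory.Rogawski1990.TwistedComparisonSpectralSide                   -- ★ `TwistedComparisonData`, `Laws`, `eq1383_of_laws`, `mSum`, `GermClass`
import HarnessLib

/-!
# h413 ∕ Track B «K2-LIT», line `K2_E1_TraceFormulaBeta`, row 13 ∕ row 22 (d): `PinnedEq1383Hyp` ⟸ «THE LAWS OF ANY TWISTED-COMPARISON DATUM EXTENDING THE PINNED FUNCTIONALS»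
# (helper `K2E1PinnedEqOfLaws`, SQ4 option (c) of K2E1-p08 (g2)'s survey `K2/K2E1-p08/g2/MEMO-SQ4-SpectralTermsConcrete-survey.md`, dealer K2E1-plan (g2) 2026-09-04T00:27:31Z)

Cell `pub/hodgecm-mathlib`, crux H413 = `stmt-HodgeConjecture-24833`, route `HCCMUnconditional`.  THEOREMS ONLY (no `def`, no posited structure, no `sorry`); lane
`--supports stmt-HodgeConjecture-24833 --as helper`.  HONEST LABEL: HC_CM is proved only modulo the 7 printed citations (2 remaining named inputs: hLiu418 =
`stmt-HodgeConjecture-24832`, h413 = `stmt-HodgeConjecture-24833`) until rung 0 closes; this file closes no socket.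

WHAT IT SAYS.  ★ `TwistedComparisonData.eq1383_of_laws` (the kernel-checked printed deduction of (13.8.3) from the `Laws` of Rogawski's ε-twisted comparison datum `𝔨`, Props.
13.5.1 + 13.6.1 + 13.6.2 regrouped by e.v.p. + «separating by Hecke eigenvalues») concludes, on matching `S`-data, `𝔨.trIS ρ φ_S = 2 · 𝔨.mSum (𝔨.germI ρ) f_S − 𝔨.trHS ρ f^H_S` with
`mSum g f_S = Σ'_{π : t(π) = g} m(π) · 𝔨.trS π f_S`.  This IS the shape of ★ `PinnedEq1383Hyp L v m Match trTw trG trH` («`trTw φ = 2 Σᶠ_i m_i · trG i φ − trH f^H` on matched pairs»,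
★ p855340 :64) at `S = {v}`.  The present file makes that reading a THEOREM, for ANY datum `𝔨` and ANY embedding of the local test functions at `v` into `𝔨`'s `S`-carriers
(`eT : φ ↦ φ̃_S`, `eG : φ ↦ f_S`, `eH`, `eφH : f^H ↦ f^H_S, φ^H_S`) under which (i) matched pairs are `MatchS`-matched, (ii) the e.v.p. class of `t(I_{ρ̃′})` is a finite cut `r : ι ↪ 𝔊.Rep`,
(iii) `𝔨.trS (r i) (eG φ) = trG i φ`, `𝔨.𝔊.m (r i) = m i`, `𝔨.trHS ρ (eH f^H) = trH f^H`, `𝔨.trIS ρ (eT φ) = trTw φ`: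
**`pinnedEq1383Hyp_of_laws : 𝔨.Laws → ¬ 𝔊.IsTheta ρ → … → PinnedEq1383Hyp L v m Match trTw trG trH`** — (d) of ★ `Pinned1383Letter` ⟸ «`Laws` of any comparison datum whose
`{v}`-traces are the pinned functionals» (at ★ p855370 ∕ ★ p855459's pinning: `trG i φ = (cl i).classTrace νG (Φ φ)`, `trH = pinnedDiscreteSum 𝒢_H μ_H ν_H Φ_H`), BY NAME, no positing.
Row 13's remaining content (the ε-twisted carriers, continuous terms, stable distributions, germ coefficients, global packets INSIDE `𝔨`) stays socket-grade (survey memo).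

CONTENTS.  §1 `mSum_eq_finsum_of_cut` (`Σ'` over the germ class = `Σᶠ` over a finite cut enumerating it).  §2 `pinnedEq1383Hyp_of_laws`.

## References
* [Rogawski1990] J. Rogawski, *Automorphic Representations of Unitary Groups in Three Variables* (1990), §13.8 display (13.8.3) p. 218; Prop. 13.7.1 p. 213; §13.10 (13.10.1) p. 230.
* [Langlands1980] R. P. Langlands, *Base change for GL(2)* (1980), pp. 208–211 (separation by Hecke eigenvalues).
-/

set_option autoImplicit false
set_option linter.dupNamespace false  -- the mandated namespace repeats the summit's segment (`HodgeConjecture.HodgeConjecture`)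

noncomputable section

open scoped BigOperators
open NumberField IsDedekindDomain
open Literature.NumberTheory.Rogawski1990 Literature.NumberTheory.Automorphic
open Summit.HodgeConjecture.HodgeConjecture.Cruxes.H413.K2E1TraceFormulaBeta (Pl HLoc)
open Summit.HodgeConjecture.HodgeConjecture.Cruxes.H413.K2E1St1383LetterOfPinned (PinnedEq1383Hyp)

namespace Summit.HodgeConjecture.HodgeConjecture.Cruxes.H413.K2E1PinnedEqOfLaws

/-! ## §1 The e.v.p. sum over a finite cut -/

section Cut

variable {TGt TG TH : Type} (𝔨 : TwistedComparisonData TGt TG TH)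

/-- **`Σ'_{π : t(π) = g} m(π) Tr_S π(f_S) = Σᶠ_i m(r i) Tr_S (r i)(f_S)`** when the germ class `{π | t(π) = g}` is enumerated by an injective finite cut `r : ι → 𝔊.Rep` (the finitely many
discrete `π` with the given Hecke eigenvalues off `S` — §13.8 p. 219: «there are finitely many»). [cite: Rogawski1990, §13.10 (13.10.1) p. 230; §13.8 p. 219] -/
theorem mSum_eq_finsum_of_cut (g : 𝔨.Germ) (fS : 𝔨.TGS) {ι : Type} [Finite ι] (r : ι → 𝔨.𝔊.Rep) (hr : Function.Injective r)
    (hcut : ∀ π, 𝔨.germRep π = g ↔ π ∈ Set.range r) :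
    𝔨.mSum g fS = ∑ᶠ i, (𝔨.𝔊.m (r i) : ℂ) * 𝔨.trS (r i) fS := by
  classical
  -- the cut enumerates the germ class
  let e : ι ≃ 𝔨.GermClass g := Equiv.ofBijective (fun i => ⟨r i, (hcut _).2 ⟨i, rfl⟩⟩)
    ⟨fun i j h => hr (congrArg Subtype.val h), fun π => by
      obtain ⟨i, hi⟩ := (hcut π.1).1 π.2
      exact ⟨i, Subtype.ext hi⟩⟩
  haveI : Fintype ι := Fintype.ofFinite ι
  haveI : Fintype (𝔨.GermClass g) := Fintype.ofEquiv ι e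
  rw [TwistedComparisonData.mSum_def, tsum_fintype, finsum_eq_sum_of_fintype, ← e.sum_comp]
  rfl

end Cut

/-! ## §2 (d) `PinnedEq1383Hyp` from the `Laws` of any comparison datum extending the pinned functionals -/

section Pinned

variable (L : Type) [Field L] [NumberField L] [IsCMField L] (v : Pl L)
  {TGt TG TH : Type} (𝔨 : TwistedComparisonData TGt TG TH)

/-- **(13.8.3) PINNED ⟸ THE LAWS OF ANY COMPARISON DATUM EXTENDING THE PINNED FUNCTIONALS.**  Let `𝔨` be a twisted-comparison datum (★ `TwistedComparisonData`) satisfying its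
printed `Laws` (Thm 10.3.1 main equality, matching ⊗ unramified units, the germ expansion Props. 13.5.1 + 13.6.1 + 13.6.2, separation by Hecke eigenvalues, the coefficient laws),
`ρ` a discrete L-packet of `H` not of the form `ρ(θ)`; let the local test functions at `v` embed into `𝔨`'s `S`-carriers (`eT`, `eG`, `eH`, `eφH`) so that matched pairs
(`Match f^H φ`) are `MatchS`-matched, let the e.v.p. class of `t(I_{ρ̃′})` be the finite injective cut `r : ι → 𝔊.Rep` with multiplicities `m`, and let `𝔨`'s `S`-traces on the
cut, on `ρ` and on `I_{ρ̃′}` be the functionals `trG`, `trH`, `trTw` on matched pairs.  THEN ★ `PinnedEq1383Hyp L v m Match trTw trG trH`: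
«`Tr(I_{ρ̃′}(φ̃)I(ε)) = 2 Σ_i m(π_i) Tr π_i(φ ⊗ f^v) − Tr ρ(f^H ⊗ (f^v)^H)`» on every matched pair — ★ `eq1383_of_laws` read at `S = {v}`.
[cite: Rogawski1990, §13.8 display (13.8.3) p. 218; Prop. 13.7.1 p. 213] [cite: Langlands1980, pp. 208–211] -/
theorem pinnedEq1383Hyp_of_laws (hL : 𝔨.Laws) (ρ : 𝔨.𝔊.PacketH) (hρ : ¬ 𝔨.𝔊.IsTheta ρ)
    {ι : Type} [Finite ι] (r : ι → 𝔨.𝔊.Rep) (hr : Function.Injective r) (hcut : ∀ π, 𝔨.germRep π = 𝔨.germI ρ ↔ π ∈ Set.range r)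
    (m : ι → ℕ) (hm : ∀ i, 𝔨.𝔊.m (r i) = m i)
    (Match : (HLoc L v → ℂ) → (Gqs L v → ℂ) → Prop) (trTw : (Gqs L v → ℂ) → ℂ) (trG : ι → (Gqs L v → ℂ) → ℂ) (trH : (HLoc L v → ℂ) → ℂ)
    (eT : (Gqs L v → ℂ) → 𝔨.TGtS) (eG : (Gqs L v → ℂ) → 𝔨.TGS) (eH eφH : (HLoc L v → ℂ) → (Gqs L v → ℂ) → 𝔨.THS)
    (hMatch : ∀ fH φ, Match fH φ → 𝔨.MatchS (eT φ) (eG φ) (eH fH φ) (eφH fH φ))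
    (htrTw : ∀ fH φ, Match fH φ → 𝔨.trIS ρ (eT φ) = trTw φ)
    (htrG : ∀ i fH φ, Match fH φ → 𝔨.trS (r i) (eG φ) = trG i φ)
    (htrH : ∀ fH φ, Match fH φ → 𝔨.trHS ρ (eH fH φ) = trH fH) :
    PinnedEq1383Hyp L v m Match trTw trG trH := by
  intro fH φ hM
  have h := 𝔨.eq1383_of_laws hL ρ hρ (hMatch fH φ hM)
  rw [mSum_eq_finsum_of_cut 𝔨 (𝔨.germI ρ) (eG φ) r hr hcut, htrTw fH φ hM, htrH fH φ hM] at h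
  rw [h, finsum_congr fun i => by rw [hm i, htrG i fH φ hM]]

end Pinned

end Summit.HodgeConjecture.HodgeConjecture.Cruxes.H413.K2E1PinnedEqOfLaws

end
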